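import Summits.NavierStokesRegularity.FluidComputer.PalasekTowerChainGluing
import Summits.NavierStokesRegularity.FluidComputer.PalasekTowerDepth
import Summits.NavierStokesRegularity.FluidComputer.PalasekTowerReforce
import Summits.NavierStokesRegularity.FluidComputer.PalasekTowerEpisodesPinned

/-!
# The depth ladder assembled, and its interlock with the re-pinned split (by name)

Cell `ns-blowup`, seat `ns-blowup-ecbridge-1` (g2); companion of `PalasekTowerDepth.lean` (p406752:
`Registry`, `Schedule.Conforms`, `DepthTower`, `UniformDepthTowers`, `CoherentTower`,
`TowerCompactness`, `BaseIn`/`HereditaryIn`), `PalasekTowerChainGluing.lean` (p406742: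
`Realisation.ofChain`), `PalasekTowerReforce.lean` (p406876: `Schedule.silence`,
`realisation_silent_of_classInduction`) and the re-pin `PalasekTowerEpisodesPinned.lean` (p406175,
seat `ns-blowup-lean`: `Schedule.Pins`, `Margins.withStrain`, `EpisodeBasePinned`,
`EpisodeInductionPinned`). LABEL: E-C typing; WHAT THIS IS NOT: not Navier–Stokes evidence — one-line
consequences of landed declarations; no stage, tower or instance is constructed or claimed.

* §1 The assembly of SHAPE-E by name: `nonempty_realisation_of_coherentTower`,
  `nonempty_realisation_of_depth : UniformDepthTowers → TowerCompactness → Nonempty (Realisation ν R)`,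
  `palasekStep2_of_depth`, `navierStokesBreakdownR3_of_depth` (modulo W21′, via the landed bridge).
* §1b THE BOUNDED FORM: `SolutionEnvelope`, `Stage.InEnvelope`, `UniformDepthTowersBounded` (finite
  depth WITH uniform derivative bounds on the solutions — the constructor's burden anyway) and
  `TowerCompactnessBounded` (compactness from those bounds: Arzelà–Ascoli grade, NO parabolic-
  regularity engine), `UniformDepthTowersBounded.uniformDepthTowers`, `TowerCompactness.bounded`,
  `nonempty_realisation_of_depthBounded` — the recommended filing form of the sibling's pair.
* §2 INTERLOCK with the re-pin (planner RULING l.999 / ADDENDUM l.1015: the route of record files the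
  re-pinned pair; SHAPE-E is the registered next approach / sibling route; its finite rungs are the
  route's BC5 plan-only rungs): `Schedule.Conforms.pins` (a conforming schedule is pinned),
  `Margins.tower_eq_withStrain`, `DepthTower.episodeBasePinned` (rung 1 ⇒ K1R of the re-pin, at the
  same numbers `(P.Λ, P.θ)` and margin), `Margins.LevelMonotone` + `Stage.restrictOfMonotone` +
  `DepthTower.mono_of_levelMonotone` + `DepthTower.episodeBasePinned_of_levelMonotone` (every rung
  `K ≥ 1` over a level-monotone margin — e.g. the planner's register — is a K1R witness),
  `hereditaryIn_of_episodeInductionPinned` (K2R of the re-pin is heredity in EVERY design class of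
  conforming schedules), `coherentTower_of_pinned`; the re-pin's own ladder `PinnedDepth ν R Λ θ m K`
  (`PinnedDepth … 1 ↔ EpisodeBasePinned`, `DepthTower.pinnedDepth`, `PinnedDepth.mono`,
  `PinnedDepth.episodeBasePinned`, `pinnedDepth_of_episodesPinned`) — `PinnedDepth 1 wide 8 (6/5)
  (Margins.register wide) 2` is the BC5 plan-only rung of the route of record with NO extra numbers;
  `Registry.record` = the register's numbers by value plus the typist's defaults `c₃ = 32`, `c₄ = 1`,
  `radius = 1` for SHAPE-E's items (`Registry.record_sep`, `Registry.record_c₅`).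
* §3 The SILENT TAIL of the re-pinned pair, by name (planner ADDENDUM l.1015 (1): «K2R of record
  asserts AUTONOMOUS heredity», the route's declared physics bet): `Schedule.Pins.silence` (the pins
  survive silencing the force after `τ 1`), `EpisodeInductionPinned.realisation_silent` and
  `realisation_silent_of_episodesPinned` — for any margin that does not read the force (`⊤`,
  persistence, the planner's `Rigid ∧ CoreLedger` register), K1R ∧ K2R of the re-pin yield a
  realisation whose force is silent from some `b < T` on.

References: S. Palasek, arXiv:2605.13827 §4, Rem. 1.4 [cite: Palasek2026ElementaryModel, §4];
C. L. Fefferman, Clay problem description, (C) [cite: FeffermanClay2006, (C)];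
T. Tao, Anal. PDE 6 (2013), Cor. 11.4 [cite: Tao2011, Cor. 11.4].
-/

noncomputable section

namespace Summit.NavierStokesRegularity.FluidComputer.PalasekTowerClayBridge

open Set MeasureTheory Filter Topology Function
open scoped ENNReal ContDiff NNReal
open Literature.Analysis.FluidPDE

/-! ## §1 The assembly of the depth ladder, by name -/

/-- **A coherent tower realises the interface** (at the same viscosity), by `Realisation.ofChain`. [folklore] -/
theorem nonempty_realisation_of_coherentTower {ν : ℝ} {R : TowerRates} {P : Registry R}
    {m : Margins R} (h : CoherentTower ν R P m) : Nonempty (Realisation ν R) := by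
  obtain ⟨_, S, _, s, hs⟩ := h
  exact nonempty_realisation_of_chain ⟨S, s, hs⟩

/-- **THE ASSEMBLY of SHAPE-E: K1R-E ∧ K2R-E ⇒ the interface is inhabited** (at the same
viscosity), for any registry and margin. [cite: Palasek2026ElementaryModel, §4] -/
theorem nonempty_realisation_of_depth {ν : ℝ} {R : TowerRates} {P : Registry R} {m : Margins R}
    (h₁ : UniformDepthTowers ν R P m) (h₂ : TowerCompactness ν R P m) :
    Nonempty (Realisation ν R) :=
  nonempty_realisation_of_coherentTower (h₂ h₁)

/-- **Palasek's Step 2 from SHAPE-E, all viscosities.** [cite: Palasek2026ElementaryModel, §4] -/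
theorem palasekStep2_of_depth {R : TowerRates} {P : Registry R} {m : Margins R}
    (h : ∀ ν : ℝ, 0 < ν → UniformDepthTowers ν R P m ∧ TowerCompactness ν R P m) :
    PalasekStep2 R :=
  fun ν hν => nonempty_realisation_of_depth (h ν hν).1 (h ν hν).2

/-- **The E-C endpoint from SHAPE-E**: K1R-E and K2R-E at every viscosity and the forced Cor. 11.4
(`hU`) give Fefferman's (C), by the landed bridge. Conditional on all hypotheses; none is asserted.
[cite: FeffermanClay2006, (C)] [cite: Palasek2026ElementaryModel, §4] [cite: Tao2011, Cor. 11.4] -/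
theorem navierStokesBreakdownR3_of_depth {R : TowerRates} {P : Registry R} {m : Margins R}
    (hU : tao_unconditional_uniqueness_velocity_forced)
    (h : ∀ ν : ℝ, 0 < ν → UniformDepthTowers ν R P m ∧ TowerCompactness ν R P m) :
    Summit.NavierStokesRegularity.NavierStokesRegularity.NavierStokesBreakdownR3 :=
  navierStokesBreakdownR3_of_step2 R hU (palasekStep2_of_depth h)

/-! ## §1b The BOUNDED form: uniform solution (and energy) bounds in the finite-depth item make the
compactness item Arzelà–Ascoli + Fatou + closedness — no Navier–Stokes regularity engine; the bounded
pair refines the plain one monotonically and assembles identically. -/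

/-- **Uniform bounds for the SOLUTIONS of a family of stages**: `U n k` bounds the `n`-th space-time
derivative (within the slab) of the velocity on `[0, τ k] × ℝ³`, `Q n k` that of the pressure —
uniformly in the depth of the family. [folklore] -/
structure SolutionEnvelope where
  /-- velocity derivative bounds per order and slab -/
  U : ℕ → ℕ → ℝ
  /-- pressure derivative bounds per order and slab -/
  Q : ℕ → ℕ → ℝ
  /-- energy bound per slab (refuter K43: makes the limit's `Stage.energy` a one-line Fatou) -/
  E : ℕ → ℝ

/-- A stage lies in the solution envelope `W`: all space-time derivatives of `(u, p)` within each
slab `[0, τ k] × ℝ³`, `k ≤ K`, are bounded by `W`, and so is the energy on the slab. [folklore] -/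
def Stage.InEnvelope {ν : ℝ} {R : TowerRates} {S : Schedule R} {m : Margins R} {K : ℕ}
    (W : SolutionEnvelope) (s : Stage ν R S m K) : Prop :=
  ∀ k, k ≤ K → (∀ n (z : ℝ × EuclideanSpace ℝ (Fin 3)), z ∈ Icc (0 : ℝ) (S.τ k) ×ˢ univ →
    ‖iteratedFDerivWithin ℝ n (uncurry s.u) (Icc (0 : ℝ) (S.τ k) ×ˢ univ) z‖ ≤ W.U n k ∧
    ‖iteratedFDerivWithin ℝ n (uncurry s.p) (Icc (0 : ℝ) (S.τ k) ×ˢ univ) z‖ ≤ W.Q n k) ∧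
    ∀ t ∈ Icc (0 : ℝ) (S.τ k), ∫⁻ x, ‖s.u t x‖ₑ ^ 2 ≤ ENNReal.ofReal (W.E k)

/-- **K1R-E (bounded form) — UNIFORM FINITE-DEPTH TOWERS WITH UNIFORM SOLUTION BOUNDS (open; never
asserted).** One Clay envelope for data and forces AND one solution envelope such that every finite
depth is realised by a conforming schedule with a stage inside both. Stronger than
`UniformDepthTowers` by exactly the derivative bounds a construction supplies anyway.
[cite: Palasek2026ElementaryModel, §4] -/
@[conjecture] def UniformDepthTowersBounded (ν : ℝ) (R : TowerRates) (P : Registry R)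
    (m : Margins R) : Prop :=
  ∃ (V : ClayEnvelope) (W : SolutionEnvelope), ∀ K : ℕ,
    ∃ S : Schedule R, S.Conforms P V ∧ ∃ s : Stage ν R S m (K + 1), s.InEnvelope W

/-- **K2R-E (bounded form) — TOWER COMPACTNESS FROM UNIFORM SOLUTION BOUNDS (open here; Arzelà–Ascoli
grade; never asserted).** A family as in `UniformDepthTowersBounded` yields a coherent infinite
tower: subsequences of data, forces, times AND solutions converge (the solution bounds give
equicontinuity of every derivative on every compact), the limit solves the limit system classically
on every slab, and every clause is closed (for limit-closed margins). No parabolic-regularity input.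
[folklore] -/
@[conjecture] def TowerCompactnessBounded (ν : ℝ) (R : TowerRates) (P : Registry R)
    (m : Margins R) : Prop :=
  UniformDepthTowersBounded ν R P m → CoherentTower ν R P m

/-- The bounded finite-depth item implies the plain one (forget the solution bounds). [folklore] -/
theorem UniformDepthTowersBounded.uniformDepthTowers {ν : ℝ} {R : TowerRates} {P : Registry R}
    {m : Margins R} (h : UniformDepthTowersBounded ν R P m) : UniformDepthTowers ν R P m := by
  obtain ⟨V, _, hK⟩ := h
  refine ⟨V, fun K => ?_⟩
  obtain ⟨S, hS, s, _⟩ := hK K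
  exact ⟨S, hS, ⟨s⟩⟩

/-- The plain compactness item implies the bounded one (its hypothesis is stronger). [folklore] -/
theorem TowerCompactness.bounded {ν : ℝ} {R : TowerRates} {P : Registry R} {m : Margins R}
    (h : TowerCompactness ν R P m) : TowerCompactnessBounded ν R P m :=
  fun h' => h h'.uniformDepthTowers

/-- **Assembly of the bounded pair**: K1R-E (bounded) ∧ K2R-E (bounded) ⇒ the interface is inhabited.
[cite: Palasek2026ElementaryModel, §4] -/
theorem nonempty_realisation_of_depthBounded {ν : ℝ} {R : TowerRates} {P : Registry R}
    {m : Margins R} (h₁ : UniformDepthTowersBounded ν R P m) (h₂ : TowerCompactnessBounded ν R P m) :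
    Nonempty (Realisation ν R) :=
  nonempty_realisation_of_coherentTower (h₂ h₁)

/-! ## §2 Interlock with the re-pinned split -/

/-- **A conforming schedule is pinned** at the registered numbers (the four pins of
`Schedule.Conforms` are verbatim those of `Schedule.Pins`). [folklore] -/
theorem Schedule.Conforms.pins {R : TowerRates} {P : Registry R} {V : ClayEnvelope} {S : Schedule R}
    (hS : S.Conforms P V) : S.Pins P.Λ P.θ :=
  ⟨hS.impulse, hS.sep, hS.datum_confined, hS.force_confined⟩

/-- The registered margin of SHAPE-E is the re-pin's strain floor on top of persistence,
definitionally. [folklore] -/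
theorem Margins.tower_eq_withStrain (R : TowerRates) (κ : ℝ) :
    Margins.tower R κ = Margins.withStrain (Margins.persist R κ) :=
  rfl

/-- **A tower of depth one is a re-pinned base** at the same numbers and margin: the first rung of
the depth ladder discharges K1R of the re-pin. [folklore] -/
theorem DepthTower.episodeBasePinned {ν : ℝ} {R : TowerRates} {P : Registry R} {V : ClayEnvelope}
    {m : Margins R} (h : DepthTower ν R P V (Margins.withStrain m) 1) :
    EpisodeBasePinned ν R P.Λ P.θ m := by
  obtain ⟨S, hS, hs⟩ := h
  exact ⟨S, hS.pins, hs⟩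

/-- **Every deeper rung is a re-pinned base too** (restriction to level `1`, for the ladder's own
margin). [folklore] -/
theorem DepthTower.episodeBasePinned_of_le {ν : ℝ} {R : TowerRates} {P : Registry R}
    {V : ClayEnvelope} {κ : ℝ} {K : ℕ} (hK : 1 ≤ K) (h : DepthTower ν R P V (Margins.tower R κ) K) :
    EpisodeBasePinned ν R P.Λ P.θ (Margins.persist R κ) :=
  DepthTower.episodeBasePinned (m := Margins.persist R κ) (DepthTower.mono hK h)

/-- A margin is **monotone in the level** if a deeper stage's margin implies every shallower one
(true for `⊤`, persistence, the strain floor, the Kelvin/core ledgers, the planner's register —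
all of the form `∀ j ≤ k, …` plus schedule-level conjuncts). [folklore] -/
def Margins.LevelMonotone {R : TowerRates} (m : Margins R) : Prop :=
  ∀ (S : Schedule R) (k k' : ℕ) (u : ℝ → EuclideanSpace ℝ (Fin 3) → EuclideanSpace ℝ (Fin 3)),
    k ≤ k' → m S k' u → m S k u

/-- The strain floor on top of a level-monotone margin is level-monotone. [folklore] -/
theorem Margins.LevelMonotone.withStrain {R : TowerRates} {m : Margins R} (hm : m.LevelMonotone) :
    (Margins.withStrain m).LevelMonotone :=
  fun S k k' u hk h => ⟨fun j hj => h.1 j (le_trans hj hk), hm S k k' u hk h.2⟩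

/-- Persistence is level-monotone. [folklore] -/
theorem Margins.levelMonotone_persist (R : TowerRates) (κ : ℝ) :
    (Margins.persist R κ).LevelMonotone :=
  fun _ _ _ _ hk h j hj => h j (le_trans hj hk)

/-- Restriction of a stage to an earlier level, for any level-monotone margin. [folklore] -/
def Stage.restrictOfMonotone {ν : ℝ} {R : TowerRates} {S : Schedule R} {m : Margins R}
    (hm : m.LevelMonotone) {k k' : ℕ} (hk : k ≤ k') (s : Stage ν R S m k') : Stage ν R S m k where
  u := s.u
  p := s.p
  classical := s.classical.mono (Icc_subset_Icc_right (S.τ_mono hk)) (uniqueDiffOn_Icc (S.τ_pos k))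
  initial := s.initial
  energy := by
    obtain ⟨C, hC, hb⟩ := s.energy
    exact ⟨C, hC, fun t ht => hb t ⟨ht.1, le_trans ht.2 (S.τ_mono hk)⟩⟩
  floor j hj := s.floor j (le_trans hj hk)
  ceiling j hj := s.ceiling j (le_trans hj hk)
  quiet j hj := s.quiet j (le_trans hj hk)
  margin := hm S k k' s.u hk s.margin

/-- **The ladder is a ladder for every level-monotone margin.** [folklore] -/
theorem DepthTower.mono_of_levelMonotone {ν : ℝ} {R : TowerRates} {P : Registry R}
    {V : ClayEnvelope} {m : Margins R} (hm : m.LevelMonotone) {K K' : ℕ} (hK : K ≤ K')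
    (h : DepthTower ν R P V m K') : DepthTower ν R P V m K := by
  obtain ⟨S, hS, ⟨s⟩⟩ := h
  exact ⟨S, hS, ⟨s.restrictOfMonotone hm hK⟩⟩

/-- **Every rung `K ≥ 1` over a level-monotone margin discharges K1R of the re-pin** (so a certified
`DepthTower … 2` — the route's BC5 plan-only rung — is in particular a witness of `EpisodeBasePinned`
at the same numbers and margin). [folklore] -/
theorem DepthTower.episodeBasePinned_of_levelMonotone {ν : ℝ} {R : TowerRates} {P : Registry R}
    {V : ClayEnvelope} {m : Margins R} (hm : m.LevelMonotone) {K : ℕ} (hK : 1 ≤ K)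
    (h : DepthTower ν R P V (Margins.withStrain m) K) : EpisodeBasePinned ν R P.Λ P.θ m :=
  (DepthTower.mono_of_levelMonotone hm.withStrain hK h).episodeBasePinned

/-- **The re-pinned induction is heredity in EVERY design class of conforming schedules** (at the
strained margin): K2R of the re-pin discharges `HereditaryIn 𝒟` for any `𝒟`. [folklore] -/
theorem hereditaryIn_of_episodeInductionPinned {ν : ℝ} {R : TowerRates} {P : Registry R}
    {V : ClayEnvelope} {m : Margins R} (𝒟 : Schedule R → Prop)
    (h : EpisodeInductionPinned ν R P.Λ P.θ m) : HereditaryIn ν R P V (Margins.withStrain m) 𝒟 :=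
  fun S _ hS n s => h S hS.pins (n + 1) (Nat.succ_pos n) s

/-- **Rung 1 of the ladder plus K2R of the re-pin give a coherent tower** (no compactness): the two
shapes compose. [folklore] -/
theorem coherentTower_of_pinned {ν : ℝ} {R : TowerRates} {P : Registry R} {V : ClayEnvelope}
    {m : Margins R} (h₁ : DepthTower ν R P V (Margins.withStrain m) 1)
    (h₂ : EpisodeInductionPinned ν R P.Λ P.θ m) : CoherentTower ν R P (Margins.withStrain m) := by
  obtain ⟨S, hS, hs⟩ := h₁
  exact coherentTower_of_hereditaryIn (𝒟 := fun _ => True) ⟨S, trivial, hS, hs⟩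
    (hereditaryIn_of_episodeInductionPinned _ h₂)

/-- **Pinned depth `K`** — the re-pin's own ladder (no registry, no envelope): some pinned schedule
admits a strained stage at level `K`. `PinnedDepth … 1` is `EpisodeBasePinned` verbatim; `PinnedDepth
… 2` is the natural BC5 plan-only rung of the route of record (the first hand-over, one level below
K2R's range), and every `DepthTower` rung is a `PinnedDepth` rung at the registry's numbers.
[cite: Palasek2026ElementaryModel, §4] -/
@[conjecture] def PinnedDepth (ν : ℝ) (R : TowerRates) (Λ θ : ℝ) (m : Margins R) (K : ℕ) : Prop :=
  ∃ S : Schedule R, S.Pins Λ θ ∧ Nonempty (Stage ν R S (Margins.withStrain m) K)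

/-- The first pinned rung is K1R of the re-pin, verbatim. [folklore] -/
theorem pinnedDepth_one_iff {ν : ℝ} {R : TowerRates} {Λ θ : ℝ} {m : Margins R} :
    PinnedDepth ν R Λ θ m 1 ↔ EpisodeBasePinned ν R Λ θ m :=
  Iff.rfl

/-- A registry rung is a pinned rung at the registry's numbers. [folklore] -/
theorem DepthTower.pinnedDepth {ν : ℝ} {R : TowerRates} {P : Registry R} {V : ClayEnvelope}
    {m : Margins R} {K : ℕ} (h : DepthTower ν R P V (Margins.withStrain m) K) :
    PinnedDepth ν R P.Λ P.θ m K := by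
  obtain ⟨S, hS, hs⟩ := h
  exact ⟨S, hS.pins, hs⟩

/-- The pinned ladder is a ladder for level-monotone margins. [folklore] -/
theorem PinnedDepth.mono {ν : ℝ} {R : TowerRates} {Λ θ : ℝ} {m : Margins R} (hm : m.LevelMonotone)
    {K K' : ℕ} (hK : K ≤ K') (h : PinnedDepth ν R Λ θ m K') : PinnedDepth ν R Λ θ m K := by
  obtain ⟨S, hS, ⟨s⟩⟩ := h
  exact ⟨S, hS, ⟨s.restrictOfMonotone hm.withStrain hK⟩⟩

/-- **Every pinned rung `K ≥ 1` is a K1R witness** (level-monotone margin). [folklore] -/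
theorem PinnedDepth.episodeBasePinned {ν : ℝ} {R : TowerRates} {Λ θ : ℝ} {m : Margins R}
    (hm : m.LevelMonotone) {K : ℕ} (hK : 1 ≤ K) (h : PinnedDepth ν R Λ θ m K) :
    EpisodeBasePinned ν R Λ θ m :=
  pinnedDepth_one_iff.1 (h.mono hm hK)

/-- **K1R ∧ K2R of the re-pin give every pinned depth** (iterate the induction from the base;
`Assembly.chain`). [folklore] -/
theorem pinnedDepth_of_episodesPinned {ν : ℝ} {R : TowerRates} {Λ θ : ℝ} {m : Margins R}
    (h₁ : EpisodeBasePinned ν R Λ θ m) (h₂ : EpisodeInductionPinned ν R Λ θ m) (K : ℕ) :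
    PinnedDepth ν R Λ θ m (K + 1) := by
  obtain ⟨S, hS, ⟨s₁⟩⟩ := h₁
  have step : ∀ n, ∀ s : Stage ν R S (Margins.withStrain m) (n + 1),
      ∃ s' : Stage ν R S (Margins.withStrain m) (n + 1 + 1), s.Extends s' :=
    fun n s => h₂ S hS (n + 1) (Nat.succ_pos n) s
  exact ⟨S, hS, ⟨Assembly.chain s₁ step K⟩⟩

/-- **The registry of record for SHAPE-E over the planner's REGISTER v2.1** (`TowerRates.wide`;
STATUS l.1039): the register's numbers by value — `c₁ = 1`, `c₂ = 5/3`, `c₅ = 4bβ`, impulse `Λ = 8`,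
separation `θ = 6/5` (so `θ c₂ = 2`: the separation pin is `TowerRates.wide_sep` exactly) — and, for
the three numbers the re-pinned route leaves free per schedule but SHAPE-E registers (that is what
makes «uniform in the depth» meaningful), the typist's defaults: clock witness `c₃ = 32` (lean g2's
window-sum bound on `wide`), push constant `c₄ = 1` (the loosest, `c₄ ≤ c₁`), ball `radius = 1`
(level `0` lives at scale `1/256` inside the unit ball; datum and force confined to it), persistence
`κ = 1/2`. The planner may re-register `c₃`, `c₄`, `radius`; nothing else depends on them. [folklore] -/
def Registry.record : Registry TowerRates.wide where
  c₁ := 1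
  c₂ := 5 / 3
  c₃ := 32
  c₄ := 1
  c₅ := 4 * (11 / 10) * (23 / 10)
  radius := 1
  Λ := 8
  θ := 6 / 5
  κ := 1 / 2
  c₁_pos := by norm_num
  c₁_le_c₂ := by norm_num
  radius_pos := by norm_num
  Λ_nonneg := by norm_num
  one_le_θ := by norm_num
  κ_pos := by norm_num

/-- The registered separation of `Registry.record` is carried by the wide-base rates at every level:
`θ (c₂ Y_k) = 2 Y_k ≤ Y_{k+1}` (`TowerRates.wide_sep`). [folklore] -/
theorem Registry.record_sep (k : ℕ) :
    Registry.record.θ * (Registry.record.c₂ * TowerRates.wide.Y k) ≤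
      Registry.record.c₁ * TowerRates.wide.Y (k + 1) := by
  have h := TowerRates.wide_sep k
  have e : Registry.record.θ * (Registry.record.c₂ * TowerRates.wide.Y k) = 2 * TowerRates.wide.Y k := by
    simp only [Registry.record]; ring
  rw [e]
  simpa [Registry.record] using h

/-- The window constant of `Registry.record` is the register's `4 b β` on `wide`. [folklore] -/
theorem Registry.record_c₅ : Registry.record.c₅ = 4 * TowerRates.wide.b * TowerRates.wide.β := rfl

/-! ## §3 The silent tail of the re-pinned pair, by name -/

/-- **The pins survive silencing** the force after `τ 1`: impulse and separation do not read the
force; confinement of the datum is kept and confinement of the force is inherited by `χ • f`.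
[folklore] -/
theorem Schedule.Pins.silence {R : TowerRates} {S : Schedule R} {Λ θ : ℝ} (hS : S.Pins Λ θ) (b : ℝ) :
    (S.silence b hS.force_confined).Pins Λ θ :=
  ⟨hS.impulse, hS.sep, hS.datum_confined, Schedule.silence_confined⟩

/-- A margin is **force-blind** if it survives re-forcing (it reads the schedule only through its
times, constants, ball, datum and loops — true for `⊤`, persistence, the Kelvin ledger, the
planner's `Rigid ∧ CoreLedger` register). [folklore] -/
def Margins.ForceBlind {R : TowerRates} (m : Margins R) : Prop :=
  ∀ (S : Schedule R) (g : ℝ → EuclideanSpace ℝ (Fin 3) → EuclideanSpace ℝ (Fin 3))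
    (h₁ : IsSmoothOnHalfSpace g) (h₂ : HasRapidSpaceTimeDecay g)
    (h₃ : ∀ t, S.T ≤ t → ∀ x, g t x = 0)
    (h₄ : ∀ k, ∀ t ∈ Icc (S.τ k) (S.τ (k + 1)), ∀ x, ‖g t x‖ ≤ S.c₄ * R.Y k)
    (k : ℕ) (u : ℝ → EuclideanSpace ℝ (Fin 3) → EuclideanSpace ℝ (Fin 3)),
    m S k u → m (S.reforce g h₁ h₂ h₃ h₄) k u

/-- The trivial margin is force-blind. [folklore] -/
theorem Margins.forceBlind_top {R : TowerRates} : Margins.ForceBlind (R := R) (fun _ _ _ => True) :=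
  fun _ _ _ _ _ _ _ _ _ => trivial

/-- Persistence is force-blind. [folklore] -/
theorem Margins.forceBlind_persist (R : TowerRates) (κ : ℝ) : (Margins.persist R κ).ForceBlind :=
  fun _ _ _ _ _ _ _ _ h => h

/-- The strain floor on top of a force-blind margin is force-blind. [folklore] -/
theorem Margins.ForceBlind.withStrain {R : TowerRates} {m : Margins R} (hm : m.ForceBlind) :
    (Margins.withStrain m).ForceBlind :=
  fun S g h₁ h₂ h₃ h₄ k u h => ⟨h.1, hm S g h₁ h₂ h₃ h₄ k u h.2⟩

/-- **K2R of the re-pin makes every pinned strained level-1 stage the start of an AUTONOMOUS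
cascade**: for a force-blind margin, the schedule with its force cut off smoothly after `τ 1`
(silent from any `b > τ 1`) carries a realisation of the tower — by
`realisation_silent_of_classInduction` with the class `(·.Pins Λ θ)`. [cite: Palasek2026ElementaryModel, §4] -/
theorem EpisodeInductionPinned.realisation_silent {ν : ℝ} {R : TowerRates} {Λ θ : ℝ} {m : Margins R}
    (h₂ : EpisodeInductionPinned ν R Λ θ m) (hm : m.ForceBlind) {S : Schedule R} (hS : S.Pins Λ θ)
    (s₁ : Stage ν R S (Margins.withStrain m) 1) {b : ℝ} (hb : S.τ 1 < b) :
    ∃ W : Realisation ν R, (∀ t, b ≤ t → ∀ x, W.f t x = 0) ∧ W.T = S.T := by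
  have hm' : Margins.withStrain m (S.silence b hS.force_confined) 1 s₁.u :=
    hm.withStrain S (S.silenced (S.τ 1) b) Schedule.silenced_smooth
      (Schedule.silenced_decay hS.force_confined) Schedule.silenced_silent
      Schedule.silenced_push_small 1 s₁.u s₁.margin
  exact realisation_silent_of_classInduction (𝒞 := fun S' : Schedule R => S'.Pins Λ θ)
    (m := Margins.withStrain m) (fun S' hS' k hk s => h₂ S' hS' k hk s) s₁ hS.force_confined hb
    (hS.silence b) hm'

/-- **The re-pinned pair asserts the silent tail**: K1R ∧ K2R of the re-pin (force-blind margin)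
yield a realisation of the tower whose force vanishes identically from some time `b` STRICTLY
BEFORE its blow-up time — an unforced cascade on `(b, T)` from the smooth finite-energy state
`u(b)`. (Planner ADDENDUM l.1015: this is the route's declared physics bet «autonomous heredity»;
in Palasek's model the force is necessary for blow-up, Rem. 1.4.) [cite: Palasek2026ElementaryModel, §4 and Rem. 1.4] -/
theorem realisation_silent_of_episodesPinned {ν : ℝ} {R : TowerRates} {Λ θ : ℝ} {m : Margins R}
    (h₁ : EpisodeBasePinned ν R Λ θ m) (h₂ : EpisodeInductionPinned ν R Λ θ m) (hm : m.ForceBlind) :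
    ∃ W : Realisation ν R, ∃ b, b < W.T ∧ ∀ t, b ≤ t → ∀ x, W.f t x = 0 := by
  obtain ⟨S, hS, ⟨s₁⟩⟩ := h₁
  have hb : S.τ 1 < (S.τ 1 + S.T) / 2 := by linarith [S.τ_lt_T 1]
  have hbT : (S.τ 1 + S.T) / 2 < S.T := by linarith [S.τ_lt_T 1]
  obtain ⟨W, hW, hT⟩ := h₂.realisation_silent hm hS s₁ hb
  refine ⟨W, (S.τ 1 + S.T) / 2, ?_, hW⟩
  rw [hT]
  exact hbT

end Summit.NavierStokesRegularity.FluidComputer.PalasekTowerClayBridge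

end
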